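import Mathlib
import Literature.NumberTheory.Transcendental.KZSemialgebraicComplex
import Literature.NumberTheory.Transcendental.KZIntervalPeriodProofs
import Literature.NumberTheory.Transcendental.SemialgebraicLineDeriv
import Literature.NumberTheory.Transcendental.KZPeriodsProofs

/-!
# `TateFamilyKernelCurves` (stmt-KontsevichZagierPeriods-9132), line `Sketch` — stub `stub_realPart`

Real form of the Hermite reduction of a real rational integrand `p/q` on `[0,1]` and its integral.
Given real polynomials `p, q` with real-algebraic coefficients, `q ≠ 0` on `[0,1]`, and the complex
Hermite reduction `p q = R′ q − R q′ + q Σ_ρ A_ρ (q /ₘ (X − ρ))` over the distinct complex roots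
`ρ` of `q` (with `R`, `ρ`, `A_ρ` algebraic), we evaluate at a real `t ∈ [0,1]`, divide by
`q(t)²` (`(q /ₘ (X − ρ))(t) (t − ρ) = q(t)`), and take real parts: with `ρ = a + ib`,
`V = (t − a)² + b²`, `Re (A/(t − ρ)) = (Re A (t − a) − Im A · b)/V`. This gives
`p/q = g + Σᵢ hᵢ·2(t − aᵢ)/Vᵢ + Σⱼ βⱼ b′ⱼ/V′ⱼ` with `G = Re R(t)/q(t)`, `g = G′` (quotient rule and
`HasDerivAt.real_of_complex`), `hᵢ = Re Aᵢ/2` over all distinct roots, and the angle data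
normalised to `b′ⱼ = |bⱼ| > 0`, `βⱼ = −Im Aⱼ · bⱼ/|bⱼ|` (`b′ = 1`, `β = 0` at real roots). All
constants are real algebraic (`isAlgebraic_re_im`), `G` is `ℚ`-semialgebraic on the closed band
(closure properties of `IsSemialgebraicFunOn`), and the identity is integrated over `[0,1]` by the
fundamental theorem of calculus with the primitives `G`, `hᵢ log Vᵢ`, `βⱼ arctan((t − a′ⱼ)/b′ⱼ)`.
Inputs: Mathlib (polynomial calculus, `intervalIntegral.integral_eq_sub_of_hasDerivAt_of_le`) and
the tree's semialgebraic-function API (`KZSemialgebraicComplex`, `SemialgebraicLineDeriv`,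
`KZIntervalPeriodProofs`, `KZPeriodsProofs`).
-/

noncomputable section

open MeasureTheory Set Polynomial
open Literature.NumberTheory.Transcendental
open Literature.ModelTheory.ExponentialFields (IsSemialgebraic isSemialgebraic_univ)

namespace Summit.KontsevichZagierPeriods.InverseLandau

/-- A finite set of complex numbers is enumerated by some `Fin m`; sums over the set become sums
over `Fin m`. [folklore] -/
theorem rp_exists_enum (S : Finset ℂ) : ∃ (m : ℕ) (ρ : Fin m → ℂ), (∀ i, ρ i ∈ S) ∧
    ∀ F : ℂ → ℝ, ∑ i, F (ρ i) = ∑ x ∈ S, F x := by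
  refine ⟨S.card, fun i => (S.equivFin.symm i : ℂ), fun i => (S.equivFin.symm i).2, fun F => ?_⟩
  rw [← Finset.sum_coe_sort S F]
  exact S.equivFin.symm.sum_comp (fun x : S => F x)

/-- A polynomial with algebraic coefficients takes algebraic values at algebraic points.
[folklore] -/
theorem rp_isAlgebraic_eval {K : Type*} [Field K] [Algebra ℚ K] {T : Polynomial K}
    (hT : ∀ i, IsAlgebraic ℚ (T.coeff i)) {x : K} (hx : IsAlgebraic ℚ x) :
    IsAlgebraic ℚ (T.eval x) := by
  rw [Polynomial.eval_eq_sum, Polynomial.sum_def]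
  exact Finset.sum_induction _ (IsAlgebraic ℚ) (fun _ _ ha hb => ha.add hb) isAlgebraic_zero
    fun i _ => (hT i).mul (hx.pow _)

/-- Evaluating the complexification of a real polynomial at a real point. [folklore] -/
theorem rp_eval_map_ofReal (q : Polynomial ℝ) (t : ℝ) :
    (q.map (algebraMap ℝ ℂ)).eval (t : ℂ) = ((q.eval t : ℝ) : ℂ) := by
  show (q.map (algebraMap ℝ ℂ)).eval (algebraMap ℝ ℂ t) = algebraMap ℝ ℂ (q.eval t)
  rw [eval_map, eval₂_at_apply]

/-- The real part of a complex polynomial at a real point is a real polynomial expression in the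
point, with the real parts of the coefficients as coefficients. [folklore] -/
theorem rp_re_eval_ofReal (R : Polynomial ℂ) (s : ℝ) :
    (R.eval (s : ℂ)).re = ∑ n ∈ R.support, (R.coeff n).re * s ^ n := by
  rw [Polynomial.eval_eq_sum, Polynomial.sum_def, Complex.re_sum]
  refine Finset.sum_congr rfl fun n _ => ?_
  rw [← Complex.ofReal_pow, Complex.re_mul_ofReal]

/-- The closed unit band of `ℝ¹` is `ℚ`-semialgebraic. [folklore] -/
theorem rp_isSemialgebraic_Icc :
    IsSemialgebraic ℚ {x : Fin 1 → ℝ | x 0 ∈ Set.Icc (0 : ℝ) 1} := by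
  have hu : IsSemialgebraic ℚ (univ : Set (Fin 1 → ℝ)) := isSemialgebraic_univ
  have hx : IsSemialgebraicFunOn ℚ univ (fun x : Fin 1 → ℝ => x 0) :=
    isSemialgebraicFunOn_apply hu 0
  have h1 := (hx.fun_sub
    (isSemialgebraicFunOn_const_of_isAlgebraic hu isAlgebraic_zero)).isSemialgebraic_sep_nonneg
  have h2 := ((isSemialgebraicFunOn_const_of_isAlgebraic hu isAlgebraic_one).fun_sub
    hx).isSemialgebraic_sep_nonneg
  convert h1.inter h2 using 1
  ext x
  simp only [mem_setOf_eq, mem_Icc, mem_inter_iff, mem_univ, true_and, sub_nonneg]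

/-- A real polynomial with algebraic coefficients is a `ℚ`-semialgebraic function of `x 0` on
every `ℚ`-semialgebraic subset of `ℝ¹`. [folklore] -/
theorem rp_isSemialgebraicFunOn_eval {W : Set (Fin 1 → ℝ)} (hW : IsSemialgebraic ℚ W)
    {T : Polynomial ℝ} (hT : ∀ i, IsAlgebraic ℚ (T.coeff i)) :
    IsSemialgebraicFunOn ℚ W (fun z => T.eval (z 0)) := by
  have h : IsSemialgebraicFunOn ℚ W (fun z => ∑ i ∈ T.support, T.coeff i * (z 0) ^ i) :=
    IsSemialgebraicFunOn.fun_finsetSum _ hW fun i _ =>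
      (isSemialgebraicFunOn_const_of_isAlgebraic hW (hT i)).fun_mul
        ((isSemialgebraicFunOn_apply hW 0).fun_pow i)
  refine h.congr fun z _ => ?_
  rw [Polynomial.eval_eq_sum, Polynomial.sum_def]

/-- The real part of a complex polynomial with algebraic coefficients, restricted to the real
line, is a `ℚ`-semialgebraic function of `x 0` on every `ℚ`-semialgebraic subset of `ℝ¹`.
[folklore] -/
theorem rp_isSemialgebraicFunOn_re_eval {W : Set (Fin 1 → ℝ)} (hW : IsSemialgebraic ℚ W)
    {R : Polynomial ℂ} (hR : ∀ i, IsAlgebraic ℚ (R.coeff i)) :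
    IsSemialgebraicFunOn ℚ W (fun z => (R.eval ((z 0 : ℝ) : ℂ)).re) := by
  have h : IsSemialgebraicFunOn ℚ W (fun z => ∑ i ∈ R.support, (R.coeff i).re * (z 0) ^ i) :=
    IsSemialgebraicFunOn.fun_finsetSum _ hW fun i _ =>
      (isSemialgebraicFunOn_const_of_isAlgebraic hW (isAlgebraic_re_im (hR i)).1).fun_mul
        ((isSemialgebraicFunOn_apply hW 0).fun_pow i)
  exact h.congr fun z _ => (rp_re_eval_ofReal R (z 0)).symm

/-- Real part of a simple fraction at a real point: with `ρ = a + ib`,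
`Re (A/(t - ρ)) = (Re A · (t - a) - Im A · b)/((t - a)² + b²)`. [folklore] -/
theorem rp_re_div (A ρ : ℂ) (t : ℝ) : (A / ((t : ℂ) - ρ)).re =
    (A.re * (t - ρ.re) - A.im * ρ.im) / ((t - ρ.re) ^ 2 + ρ.im ^ 2) := by
  have hn : Complex.normSq ((t : ℂ) - ρ) = (t - ρ.re) ^ 2 + ρ.im ^ 2 := by
    rw [Complex.normSq_apply, Complex.sub_re, Complex.sub_im, Complex.ofReal_re, Complex.ofReal_im]
    ring
  rw [Complex.div_re, hn, Complex.sub_re, Complex.sub_im, Complex.ofReal_re, Complex.ofReal_im]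
  ring

/-- The quadratic `(t - Re ρ)² + (Im ρ)²` does not vanish at a real non-root `t` of `q` when `ρ`
is a complex root of `q`. [folklore] -/
theorem rp_V_ne_zero {q : Polynomial ℝ} {ρ : ℂ} (hρ : ρ ∈ (q.map (algebraMap ℝ ℂ)).roots)
    {t : ℝ} (hqt : q.eval t ≠ 0) : (t - ρ.re) ^ 2 + ρ.im ^ 2 ≠ 0 := by
  intro h0
  have h1 : (t - ρ.re) ^ 2 = 0 := by nlinarith [sq_nonneg (t - ρ.re), sq_nonneg ρ.im]
  have h2 : ρ.im ^ 2 = 0 := by nlinarith [sq_nonneg (t - ρ.re), sq_nonneg ρ.im]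
  have hre : ρ.re = t := by have := pow_eq_zero_iff (n := 2) two_ne_zero |>.mp h1; linarith
  have him : ρ.im = 0 := pow_eq_zero_iff (n := 2) two_ne_zero |>.mp h2
  have hρt : ρ = (t : ℂ) := Complex.ext (by simp [hre]) (by simp [him])
  have hroot := (mem_roots'.mp hρ).2
  rw [hρt, IsRoot.def, rp_eval_map_ofReal, Complex.ofReal_eq_zero] at hroot
  exact hqt hroot

/-- The complexified root is not the real evaluation point. [folklore] -/
theorem rp_ne_root {q : Polynomial ℝ} {ρ : ℂ} (hρ : ρ ∈ (q.map (algebraMap ℝ ℂ)).roots)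
    {t : ℝ} (hqt : q.eval t ≠ 0) : (t : ℂ) - ρ ≠ 0 := by
  intro h0
  have hροt : ρ = (t : ℂ) := (sub_eq_zero.mp h0).symm
  have hroot := (mem_roots'.mp hρ).2
  rw [hροt, IsRoot.def, rp_eval_map_ofReal, Complex.ofReal_eq_zero] at hroot
  exact hqt hroot

/-- Evaluating the Hermite reduction at a real non-root `t` of `q` and taking real parts:
`p/q = ((Re R)′ q − (Re R) q′)/q² + Σ_ρ (Re A_ρ (t − Re ρ) − Im A_ρ Im ρ)/((t − Re ρ)² + (Im ρ)²)`.
[folklore] -/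
theorem rp_pointwise (p q : Polynomial ℝ) (R : Polynomial ℂ) (A : ℂ → ℂ)
    (hid : p.map (algebraMap ℝ ℂ) * q.map (algebraMap ℝ ℂ) =
      derivative R * q.map (algebraMap ℝ ℂ) - R * derivative (q.map (algebraMap ℝ ℂ)) +
        q.map (algebraMap ℝ ℂ) * ∑ ρ ∈ (q.map (algebraMap ℝ ℂ)).roots.toFinset,
          C (A ρ) * (q.map (algebraMap ℝ ℂ) /ₘ (X - C ρ)))
    {t : ℝ} (hqt : q.eval t ≠ 0) :
    p.eval t / q.eval t =
      (((derivative R).eval (t : ℂ)).re * q.eval t - (R.eval (t : ℂ)).re * (derivative q).eval t) /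
          (q.eval t) ^ 2 +
        ∑ ρ ∈ (q.map (algebraMap ℝ ℂ)).roots.toFinset,
          ((A ρ).re * (t - ρ.re) - (A ρ).im * ρ.im) / ((t - ρ.re) ^ 2 + ρ.im ^ 2) := by
  have hQ : ((q.eval t : ℝ) : ℂ) ≠ 0 := Complex.ofReal_ne_zero.mpr hqt
  have hq'_ev : (derivative (q.map (algebraMap ℝ ℂ))).eval (t : ℂ) =
      (((derivative q).eval t : ℝ) : ℂ) := by
    rw [derivative_map, rp_eval_map_ofReal]
  -- the quotients `q /ₘ (X - ρ)` at `t`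
  have hdiv : ∀ ρ ∈ (q.map (algebraMap ℝ ℂ)).roots.toFinset,
      (q.map (algebraMap ℝ ℂ) /ₘ (X - C ρ)).eval (t : ℂ) =
        ((q.eval t : ℝ) : ℂ) / ((t : ℂ) - ρ) := by
    intro ρ hρ
    have hρ' : ρ ∈ (q.map (algebraMap ℝ ℂ)).roots := Multiset.mem_toFinset.mp hρ
    have hmul : (X - C ρ) * (q.map (algebraMap ℝ ℂ) /ₘ (X - C ρ)) = q.map (algebraMap ℝ ℂ) :=
      mul_divByMonic_eq_iff_isRoot.mpr (mem_roots'.mp hρ').2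
    have hev := congrArg (Polynomial.eval (t : ℂ)) hmul
    rw [eval_mul, eval_sub, eval_X, eval_C, rp_eval_map_ofReal] at hev
    rw [eq_div_iff (rp_ne_root hρ' hqt), mul_comm]
    exact hev
  -- evaluate the identity at `t`
  have hev := congrArg (Polynomial.eval (t : ℂ)) hid
  simp only [eval_mul, eval_sub, eval_add, eval_finsetSum, eval_C, rp_eval_map_ofReal,
    hq'_ev] at hev
  rw [Finset.sum_congr rfl fun ρ hρ => by rw [hdiv ρ hρ]] at hev
  -- hev : ↑p * ↑q = R' * ↑q - R * ↑q' + ↑q * Σ A ρ * (↑q / (t - ρ))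
  have hsum : ∑ ρ ∈ (q.map (algebraMap ℝ ℂ)).roots.toFinset,
      A ρ * (((q.eval t : ℝ) : ℂ) / ((t : ℂ) - ρ)) =
      ((q.eval t : ℝ) : ℂ) *
        ∑ ρ ∈ (q.map (algebraMap ℝ ℂ)).roots.toFinset, A ρ / ((t : ℂ) - ρ) := by
    rw [Finset.mul_sum]
    refine Finset.sum_congr rfl fun ρ _ => ?_
    ring
  rw [hsum] at hev
  -- divide by `q(t)²` in `ℂ`
  have hC : ((p.eval t / q.eval t : ℝ) : ℂ) =
      ((derivative R).eval (t : ℂ) * ((q.eval t : ℝ) : ℂ) -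
          R.eval (t : ℂ) * (((derivative q).eval t : ℝ) : ℂ)) / ((q.eval t : ℝ) : ℂ) ^ 2 +
        ∑ ρ ∈ (q.map (algebraMap ℝ ℂ)).roots.toFinset, A ρ / ((t : ℂ) - ρ) := by
    rw [Complex.ofReal_div]
    have : ((p.eval t : ℝ) : ℂ) / ((q.eval t : ℝ) : ℂ) =
        ((p.eval t : ℝ) : ℂ) * ((q.eval t : ℝ) : ℂ) / ((q.eval t : ℝ) : ℂ) ^ 2 := by
      rw [sq, mul_div_mul_right _ _ hQ]
    rw [this, hev, add_div, ← mul_assoc, ← sq, mul_div_cancel_left₀ _ (pow_ne_zero 2 hQ)]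
  -- take real parts
  have hre := congrArg Complex.re hC
  rw [Complex.ofReal_re, Complex.add_re, Complex.re_sum, ← Complex.ofReal_pow,
    Complex.div_ofReal_re, Complex.sub_re, Complex.re_mul_ofReal, Complex.re_mul_ofReal] at hre
  rw [hre]
  congr 1
  exact Finset.sum_congr rfl fun ρ _ => rp_re_div (A ρ) ρ t

/-- Normalised angle datum at a root with imaginary part `b` and residue imaginary part `c`:
`b' > 0` and `β`, both real algebraic, with `β b'/(s + b'²) = -(c b)/(s + b²)` for all `s`
(`b' = |b|`, `β = -c b/|b|`; `b' = 1`, `β = 0` at a real root). [folklore] -/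
theorem rp_angle_datum {b c : ℝ} (hb : IsAlgebraic ℚ b) (hc : IsAlgebraic ℚ c) :
    ∃ b' β : ℝ, IsAlgebraic ℚ b' ∧ IsAlgebraic ℚ β ∧ 0 < b' ∧
      ∀ s : ℝ, β * b' / (s + b' ^ 2) = -(c * b) / (s + b ^ 2) := by
  by_cases hb0 : b = 0
  · exact ⟨1, 0, isAlgebraic_one, isAlgebraic_zero, one_pos, fun s => by simp [hb0]⟩
  · have habs : IsAlgebraic ℚ |b| := by
      rcases abs_choice b with h | h <;> rw [h]
      exacts [hb, hb.neg]
    refine ⟨|b|, -(c * b) / |b|, habs, ?_, abs_pos.mpr hb0, fun s => ?_⟩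
    · rw [div_eq_mul_inv]
      exact (hc.mul hb).neg.mul habs.inv
    · rw [div_mul_cancel₀ _ (abs_ne_zero.mpr hb0), sq_abs]

/-- `d/dt arctan((t - a)/b) = b/((t - a)² + b²)` for `b ≠ 0`. [folklore] -/
theorem rp_hasDerivAt_arctan (a : ℝ) {b : ℝ} (hb : b ≠ 0) (t : ℝ) :
    HasDerivAt (fun t => Real.arctan ((t - a) / b)) (b / ((t - a) ^ 2 + b ^ 2)) t := by
  have hV : (t - a) ^ 2 + b ^ 2 ≠ 0 := by positivity
  refine ((((hasDerivAt_id' t).sub_const a).div_const b).arctan).congr_deriv ?_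
  field_simp
  ring

/-- `d/dt (h log((t - a)² + b²)) = h · 2(t - a)/((t - a)² + b²)` off the zero set. [folklore] -/
theorem rp_hasDerivAt_log (h a b t : ℝ) (hV : (t - a) ^ 2 + b ^ 2 ≠ 0) :
    HasDerivAt (fun t => h * Real.log ((t - a) ^ 2 + b ^ 2))
      (h * (2 * (t - a)) / ((t - a) ^ 2 + b ^ 2)) t := by
  have h1 : HasDerivAt (fun t => (t - a) ^ 2 + b ^ 2) (2 * (t - a)) t :=
    ((((hasDerivAt_id' t).sub_const a).fun_pow 2).add_const (b ^ 2)).congr_deriv (by norm_num)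
  exact ((h1.log hV).const_mul h).congr_deriv (by ring)

/-- **S2 (real form of the decomposition on `[0,1]` and its integral).** From the complex Hermite
reduction of `p/q` (real polynomials with algebraic coefficients, `q ≠ 0` on `[0,1]`): the real
decomposition `p/q = g + Σᵢ hᵢ·2(t−aᵢ)/((t−aᵢ)²+bᵢ²) + Σⱼ βⱼ b′ⱼ/((t−a′ⱼ)²+b′ⱼ²)` on `[0,1]` with
`g = G′`, `G = Re(R/q)` semialgebraic, all constants real algebraic, `b′ⱼ > 0`, and the
integrated identity (fundamental theorem of calculus with the primitives `G`, `hᵢ log Vᵢ`,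
`βⱼ arctan((t − a′ⱼ)/b′ⱼ)`). [cite: KontsevichZagier2001, §1.2] -/
theorem stub_realPart : ∀ (p q : Polynomial ℝ) (R : Polynomial ℂ) (A : ℂ → ℂ),
    (∀ n, IsAlgebraic ℚ (p.coeff n)) → (∀ n, IsAlgebraic ℚ (q.coeff n)) →
    (∀ n, IsAlgebraic ℚ (R.coeff n)) →
    (∀ ρ ∈ (q.map (algebraMap ℝ ℂ)).roots, IsAlgebraic ℚ ρ ∧ IsAlgebraic ℚ (A ρ)) →
    (∀ t ∈ Set.Icc (0 : ℝ) 1, q.eval t ≠ 0) →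
    p.map (algebraMap ℝ ℂ) * q.map (algebraMap ℝ ℂ) =
      derivative R * q.map (algebraMap ℝ ℂ) - R * derivative (q.map (algebraMap ℝ ℂ)) +
        q.map (algebraMap ℝ ℂ) * ∑ ρ ∈ (q.map (algebraMap ℝ ℂ)).roots.toFinset,
          C (A ρ) * (q.map (algebraMap ℝ ℂ) /ₘ (X - C ρ)) →
    ∃ (G g : ℝ → ℝ) (m₁ m₂ : ℕ) (a b h : Fin m₁ → ℝ) (a' b' β : Fin m₂ → ℝ),
      IsSemialgebraicFunOn ℚ {x : Fin 1 → ℝ | x 0 ∈ Set.Icc (0 : ℝ) 1} (fun x => G (x 0)) ∧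
      ContinuousOn G (Set.Icc 0 1) ∧ ContinuousOn g (Set.Icc 0 1) ∧
      (∀ t ∈ Set.Ioo (0 : ℝ) 1, HasDerivAt G (g t) t) ∧
      IsAlgebraic ℚ (G 0) ∧ IsAlgebraic ℚ (G 1) ∧
      (∀ i, IsAlgebraic ℚ (a i) ∧ IsAlgebraic ℚ (b i) ∧ IsAlgebraic ℚ (h i)) ∧
      (∀ i, ∀ t ∈ Set.Icc (0 : ℝ) 1, (t - a i) ^ 2 + (b i) ^ 2 ≠ 0) ∧
      (∀ j, IsAlgebraic ℚ (a' j) ∧ IsAlgebraic ℚ (b' j) ∧ IsAlgebraic ℚ (β j) ∧ 0 < b' j) ∧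
      (∀ t ∈ Set.Icc (0 : ℝ) 1, p.eval t / q.eval t =
        g t + ∑ i, h i * (2 * (t - a i)) / ((t - a i) ^ 2 + (b i) ^ 2) +
          ∑ j, β j * b' j / ((t - a' j) ^ 2 + (b' j) ^ 2)) ∧
      ∫ t in (0 : ℝ)..1, p.eval t / q.eval t =
        (G 1 - G 0) + ∑ i, h i * Real.log (((1 - a i) ^ 2 + (b i) ^ 2) / ((a i) ^ 2 + (b i) ^ 2)) +
          ∑ j, β j * (Real.arctan ((1 - a' j) / b' j) - Real.arctan (-a' j / b' j)) := by
  intro p q R A _hp hq hR hA hq0 hid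
  classical
  -- the distinct complex roots of `q`, enumerated by `Fin m`
  obtain ⟨m, ρ, hρS, hsumρ⟩ := rp_exists_enum (q.map (algebraMap ℝ ℂ)).roots.toFinset
  have hρ : ∀ i, ρ i ∈ (q.map (algebraMap ℝ ℂ)).roots := fun i => Multiset.mem_toFinset.mp (hρS i)
  have hρalg : ∀ i, IsAlgebraic ℚ (ρ i) := fun i => (hA _ (hρ i)).1
  have hAalg : ∀ i, IsAlgebraic ℚ (A (ρ i)) := fun i => (hA _ (hρ i)).2
  have h2 : IsAlgebraic ℚ (2 : ℝ) := by
    rw [show (2 : ℝ) = ((2 : ℕ) : ℝ) by norm_num]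
    exact isAlgebraic_nat 2
  -- the normalised angle data
  choose b' β hb' hβ hb'pos hβb' using fun i =>
    rp_angle_datum (isAlgebraic_re_im (hρalg i)).2 (isAlgebraic_re_im (hAalg i)).2
  -- the exact part `G = Re (R/q)` and its derivative `g`
  obtain ⟨G, hG⟩ : ∃ G : ℝ → ℝ, G = fun t : ℝ => (R.eval (t : ℂ)).re / q.eval t := ⟨_, rfl⟩
  obtain ⟨g, hg⟩ : ∃ g : ℝ → ℝ, g = fun t : ℝ =>
      (((derivative R).eval (t : ℂ)).re * q.eval t - (R.eval (t : ℂ)).re * (derivative q).eval t) /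
        (q.eval t) ^ 2 := ⟨_, rfl⟩
  have hgt : ∀ t, g t =
      (((derivative R).eval (t : ℂ)).re * q.eval t - (R.eval (t : ℂ)).re * (derivative q).eval t) /
        (q.eval t) ^ 2 := fun t => by rw [hg]
  have hV : ∀ i, ∀ t ∈ Set.Icc (0 : ℝ) 1, (t - (ρ i).re) ^ 2 + ((ρ i).im) ^ 2 ≠ 0 :=
    fun i t ht => rp_V_ne_zero (hρ i) (hq0 t ht)
  have hV' : ∀ i (t : ℝ), (t - (ρ i).re) ^ 2 + (b' i) ^ 2 ≠ 0 := fun i t => by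
    have := hb'pos i
    positivity
  -- continuity and differentiability of the exact part
  have hNc : Continuous fun t : ℝ => (R.eval (t : ℂ)).re := by fun_prop
  have hN'c : Continuous fun t : ℝ => ((derivative R).eval (t : ℂ)).re := by fun_prop
  have hGc : ContinuousOn G (Set.Icc 0 1) := by
    rw [hG]
    exact hNc.continuousOn.div q.continuous.continuousOn hq0
  have hgc : ContinuousOn g (Set.Icc 0 1) := by
    rw [hg]
    refine ContinuousOn.div ?_ ?_ fun t ht => pow_ne_zero 2 (hq0 t ht)
    · exact ((hN'c.mul q.continuous).sub (hNc.mul (derivative q).continuous)).continuousOn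
    · exact (q.continuous.pow 2).continuousOn
  have hGd : ∀ t ∈ Set.Ioo (0 : ℝ) 1, HasDerivAt G (g t) t := by
    intro t ht
    rw [hG, hgt]
    exact ((R.hasDerivAt (t : ℂ)).real_of_complex).div (q.hasDerivAt t)
      (hq0 t (Ioo_subset_Icc_self ht))
  -- the pointwise identity on `[0,1]`
  have hpt : ∀ t ∈ Set.Icc (0 : ℝ) 1, p.eval t / q.eval t =
      g t + ∑ i, (A (ρ i)).re / 2 * (2 * (t - (ρ i).re)) / ((t - (ρ i).re) ^ 2 + ((ρ i).im) ^ 2) +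
        ∑ j, β j * b' j / ((t - (ρ j).re) ^ 2 + (b' j) ^ 2) := by
    intro t ht
    rw [rp_pointwise p q R A hid (hq0 t ht), hgt, add_assoc, add_right_inj,
      ← Finset.sum_add_distrib,
      ← hsumρ fun x => ((A x).re * (t - x.re) - (A x).im * x.im) / ((t - x.re) ^ 2 + x.im ^ 2)]
    refine Finset.sum_congr rfl fun i _ => ?_
    rw [hβb' i ((t - (ρ i).re) ^ 2)]
    ring
  refine ⟨G, g, m, m, fun i => (ρ i).re, fun i => (ρ i).im, fun i => (A (ρ i)).re / 2,
    fun i => (ρ i).re, b', β, ?_, hGc, hgc, hGd, ?_, ?_, ?_, hV, ?_, hpt, ?_⟩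
  · -- `G` is `ℚ`-semialgebraic on the closed band
    rw [hG]
    exact (rp_isSemialgebraicFunOn_re_eval rp_isSemialgebraic_Icc hR).div
      (rp_isSemialgebraicFunOn_eval rp_isSemialgebraic_Icc hq) fun x hx => hq0 _ hx
  · -- `G 0` is algebraic
    rw [hG]
    show IsAlgebraic ℚ ((R.eval ((0 : ℝ) : ℂ)).re / q.eval 0)
    rw [Complex.ofReal_zero, div_eq_mul_inv]
    exact (isAlgebraic_re_im (rp_isAlgebraic_eval hR isAlgebraic_zero)).1.mul
      (rp_isAlgebraic_eval hq isAlgebraic_zero).inv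
  · -- `G 1` is algebraic
    rw [hG]
    show IsAlgebraic ℚ ((R.eval ((1 : ℝ) : ℂ)).re / q.eval 1)
    rw [Complex.ofReal_one, div_eq_mul_inv]
    exact (isAlgebraic_re_im (rp_isAlgebraic_eval hR isAlgebraic_one)).1.mul
      (rp_isAlgebraic_eval hq isAlgebraic_one).inv
  · -- modulus data are algebraic
    intro i
    refine ⟨(isAlgebraic_re_im (hρalg i)).1, (isAlgebraic_re_im (hρalg i)).2, ?_⟩
    dsimp only
    rw [div_eq_mul_inv]
    exact (isAlgebraic_re_im (hAalg i)).1.mul h2.inv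
  · -- angle data are algebraic, `b' > 0`
    exact fun j => ⟨(isAlgebraic_re_im (hρalg j)).1, hb' j, hβ j, hb'pos j⟩
  · -- the integrated identity (fundamental theorem of calculus)
    have hFc : ContinuousOn (fun t => G t +
        ∑ i, (A (ρ i)).re / 2 * Real.log ((t - (ρ i).re) ^ 2 + ((ρ i).im) ^ 2) +
          ∑ j, β j * Real.arctan ((t - (ρ j).re) / b' j)) (Set.Icc 0 1) := by
      refine (hGc.add (continuousOn_finsetSum _ fun i _ => ?_)).add
        (continuousOn_finsetSum _ fun j _ => ?_)
      · exact continuousOn_const.mul ((Continuous.continuousOn (by fun_prop)).log (hV i))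
      · exact Continuous.continuousOn (by fun_prop)
    have hFd : ∀ t ∈ Set.Ioo (0 : ℝ) 1, HasDerivAt (fun t => G t +
        ∑ i, (A (ρ i)).re / 2 * Real.log ((t - (ρ i).re) ^ 2 + ((ρ i).im) ^ 2) +
          ∑ j, β j * Real.arctan ((t - (ρ j).re) / b' j))
        (g t +
          ∑ i, (A (ρ i)).re / 2 * (2 * (t - (ρ i).re)) / ((t - (ρ i).re) ^ 2 + ((ρ i).im) ^ 2) +
          ∑ j, β j * b' j / ((t - (ρ j).re) ^ 2 + (b' j) ^ 2)) t := by
      intro t ht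
      refine ((hGd t ht).fun_add (HasDerivAt.fun_sum fun i _ =>
        rp_hasDerivAt_log _ _ _ t (hV i t (Ioo_subset_Icc_self ht)))).fun_add
          (HasDerivAt.fun_sum fun j _ => ?_)
      exact ((rp_hasDerivAt_arctan ((ρ j).re) (hb'pos j).ne' t).const_mul (β j)).congr_deriv
        (by rw [mul_div_assoc])
    have hfi : IntervalIntegrable (fun t => g t +
        ∑ i, (A (ρ i)).re / 2 * (2 * (t - (ρ i).re)) / ((t - (ρ i).re) ^ 2 + ((ρ i).im) ^ 2) +
          ∑ j, β j * b' j / ((t - (ρ j).re) ^ 2 + (b' j) ^ 2)) volume 0 1 := by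
      refine ContinuousOn.intervalIntegrable ?_
      rw [Set.uIcc_of_le zero_le_one]
      refine (hgc.add (continuousOn_finsetSum _ fun i _ => ?_)).add
        (continuousOn_finsetSum _ fun j _ => ?_)
      · exact ContinuousOn.div (Continuous.continuousOn (by fun_prop))
          (Continuous.continuousOn (by fun_prop)) (hV i)
      · exact continuousOn_const.div (Continuous.continuousOn (by fun_prop)) fun t _ => hV' j t
    have hFTC := intervalIntegral.integral_eq_sub_of_hasDerivAt_of_le zero_le_one hFc hFd hfi
    have hcongr : ∫ t in (0 : ℝ)..1, p.eval t / q.eval t = ∫ t in (0 : ℝ)..1, (g t +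
        ∑ i, (A (ρ i)).re / 2 * (2 * (t - (ρ i).re)) / ((t - (ρ i).re) ^ 2 + ((ρ i).im) ^ 2) +
          ∑ j, β j * b' j / ((t - (ρ j).re) ^ 2 + (b' j) ^ 2)) := by
      refine intervalIntegral.integral_congr fun t ht => ?_
      rw [Set.uIcc_of_le zero_le_one] at ht
      exact hpt t ht
    have hlogs : ∑ i, (A (ρ i)).re / 2 *
        Real.log (((1 - (ρ i).re) ^ 2 + ((ρ i).im) ^ 2) / (((ρ i).re) ^ 2 + ((ρ i).im) ^ 2)) =
        ∑ i, (A (ρ i)).re / 2 * Real.log ((1 - (ρ i).re) ^ 2 + ((ρ i).im) ^ 2) -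
          ∑ i, (A (ρ i)).re / 2 * Real.log ((0 - (ρ i).re) ^ 2 + ((ρ i).im) ^ 2) := by
      rw [← Finset.sum_sub_distrib]
      refine Finset.sum_congr rfl fun i _ => ?_
      have h1 := hV i 1 ⟨zero_le_one, le_rfl⟩
      have h0 := hV i 0 ⟨le_rfl, zero_le_one⟩
      rw [zero_sub, neg_sq] at h0 ⊢
      rw [Real.log_div h1 h0, mul_sub]
    have harcs : ∑ j, β j * (Real.arctan ((1 - (ρ j).re) / b' j) - Real.arctan (-(ρ j).re / b' j)) =
        ∑ j, β j * Real.arctan ((1 - (ρ j).re) / b' j) -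
          ∑ j, β j * Real.arctan ((0 - (ρ j).re) / b' j) := by
      rw [← Finset.sum_sub_distrib]
      refine Finset.sum_congr rfl fun j _ => ?_
      rw [zero_sub, mul_sub]
    rw [hcongr, hFTC, hlogs, harcs]
    ring

end Summit.KontsevichZagierPeriods.InverseLandau

end
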